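import Summits.ABC.StewartYu.SatCoords
import Summits.ABC.StewartYu.PadicG3TwoEndAdapter
import Summits.ABC.StewartYu.PadicG3TwoValuesGen
import HarnessLib

/-!
# Cell abc-stewartyu, WP-L.P(2) (crux r4 `PadicCoreTwoRat`, stmt-ABC-20504), set-up layer: the SATURATION DATUM of
# a `2`-adic set-up and the monomial-clearing datum of the k-step supplied from the VIRTUAL box

`Summits/ABC/StewartYu/PadicTwoSatData.lean` — cell `abc-stewartyu` (HOME `run/shared/lean/pub/abc-stewartyu/`),
route `YuMatveevShapeRat`, seat p3 (g9, WP-L.P(2) lead; design memo HOME/p3/memo-11 §2 row «𝔑 set-up»; odd-`p` model =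
p2's `PadicG3SatData`).  One structure and theorems on the M2 datum `TwoSetup`; no named fact, no parameters.

`S.SatData` records that the `d + 1` generators `all = (α, θ)` of the `2`-adic set-up `S` (in the 𝔑-threaded frame:
the SQUARED saturated basis `ϑ`, pivot last — `SatFrameKit.exists_satFrame_two`) are POSITIVE and tied to positive
ORIGINAL generators `αo` (the crux's `αⱼ²`) by `allᵢ ^ N = ∏ⱼ αoⱼ ^ Uᵢⱼ` with an integer matrix `U` and `0 < N`
(the saturation index).  From it, for a VIRTUAL box `Bv` (a bound on the virtual exponents `(κ ᵥ* U)ⱼ` of the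
exponent vector `κᵢ = (uᵢ, u_θᵢ)` of an unknown):

* `E`, `Dm` — the `αo`-box exponent `Eⱼ(x) = ⌈Bvⱼ·|x|/N⌉` at the point `x` and the clearing denominator
  `Dm = monDen αo (E x)`; `le_N_mul_E`, `E_le`, `one_le_Dm`, `log_Dm_le`, `log_Dm_le_of_weights`;
* **`exists_int_Dm_mul_zmon`** — for `|((uᵢ,u_θᵢ) ᵥ* U)ⱼ| ≤ Bvⱼ`: `Dm·zmon(uᵢ, u_θᵢ, x) ∈ ℤ`, `|·| ≤ Dm²`
  (`SatCoords.exists_int_monDen_mul_prod_zpow_sat` at `μ = x·κᵢ`), and the family form **`monomialDatum_of_vbox`** =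
  the hypothesis `hm` of `PadicG3TwoValuesGen.g3_slab_kstep_*_gen` with `Mm = Dm²`;
* `logHeight₁_zmon_le_of_vbox` — `h(zmon(uᵢ,u_θᵢ,x)) ≤ |x|·Σⱼ (Bvⱼ/N)·Vⱼ` for `h(αoⱼ) ≤ Vⱼ`;
* **`kstep_Icc_sat`**, **`kstep_cop_sat`** — the two slab k-steps of the level chain with the datum supplied.

WHAT THIS IS NOT: no construction of the datum (that is `SatFrameKit.exists_satFrame_two` + the pivot permutation, in the
assembly); no level induction; no record; no crux moves (A1.L not moved).

References: Yu. V. Nesterenko, LNM 1819 (2003) §3.5 (p.105), Lemma 3.11, §4.3 Cor 4.5; K. Yu, Acta Math. 211 (2013)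
§1.1, Lemma 5.2; HOME/p3/memo-11 §1–§2.
-/

noncomputable section

open Finset Polynomial
open scoped Matrix
open Literature.NumberTheory.Transcendental
open Literature.NumberTheory.Transcendental.PadicCW77 (condExp)

namespace Summit.ABC.StewartYu

open Literature.NumberTheory.Transcendental.CW77.Setup (Tau tauNorm)

namespace TwoSetup

variable (S : TwoSetup)

/-- **The saturation datum of a `2`-adic set-up**: the generators `all` are positive and `allᵢ ^ N = ∏ⱼ αoⱼ ^ Uᵢⱼ`
for positive ORIGINAL generators `αo`, an integer matrix `U` and an index `0 < N`.
[cite: Nesterenko2003, §3.5 and Cor 4.5; shape only] -/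
structure SatData where
  /-- the original generators (the crux's `αⱼ²`) -/
  αo : Fin (S.d + 1) → ℚ
  /-- they are positive -/
  hαo : ∀ j, 0 < αo j
  /-- the set-up's generators (the squared saturated basis) are positive -/
  hall : ∀ i, 0 < S.toQ.all i
  /-- the integer matrix `N·ū` (Cramer inverse of the change of basis) -/
  U : Matrix (Fin (S.d + 1)) (Fin (S.d + 1)) ℤ
  /-- the saturation index -/
  N : ℕ
  /-- it is positive -/
  hN : 0 < N
  /-- `allᵢ^N = ∏ⱼ αoⱼ^{Uᵢⱼ}` -/
  hU : ∀ i, S.toQ.all i ^ N = ∏ j, αo j ^ U i j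

namespace SatData

variable {S} (F : S.SatData)

/-- The original generators are non-zero. [folklore] -/
theorem αo_ne (j : Fin (S.d + 1)) : F.αo j ≠ 0 := (F.hαo j).ne'

/-- The `αo`-box exponent at the point `x` of the virtual box `Bv`: `Eⱼ(x) = ⌈Bvⱼ·|x|/N⌉`. [folklore] -/
def E (Bv : Fin (S.d + 1) → ℕ) (x : ℤ) : Fin (S.d + 1) → ℕ := fun j => (Bv j * x.natAbs + F.N - 1) / F.N

/-- `Bvⱼ·|x| ≤ N·Eⱼ(x)`. [folklore] -/
theorem le_N_mul_E (Bv : Fin (S.d + 1) → ℕ) (x : ℤ) (j : Fin (S.d + 1)) : Bv j * x.natAbs ≤ F.N * F.E Bv x j := by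
  unfold E
  have hN := F.hN
  have h := Nat.lt_div_mul_add (a := Bv j * x.natAbs + F.N - 1) hN
  rw [Nat.mul_comm F.N]
  omega

/-- `Eⱼ(x) ≤ Bvⱼ·|x|/N + 1` (real form). [folklore] -/
theorem E_le (Bv : Fin (S.d + 1) → ℕ) (x : ℤ) (j : Fin (S.d + 1)) :
    (F.E Bv x j : ℝ) ≤ (Bv j : ℝ) * |(x : ℝ)| / F.N + 1 := by
  unfold E
  have hN := F.hN
  have hNr : (0 : ℝ) < F.N := by exact_mod_cast hN
  have h1 : ((Bv j * x.natAbs + F.N - 1) / F.N : ℕ) * F.N ≤ Bv j * x.natAbs + F.N - 1 := Nat.div_mul_le_self _ _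
  have h2 : (((Bv j * x.natAbs + F.N - 1) / F.N : ℕ) : ℝ) * F.N ≤ (Bv j : ℝ) * x.natAbs + F.N := by
    have h1' : (((Bv j * x.natAbs + F.N - 1) / F.N * F.N : ℕ) : ℝ) ≤ ((Bv j * x.natAbs + F.N - 1 : ℕ) : ℝ) := by
      exact_mod_cast h1
    have h3 : ((Bv j * x.natAbs + F.N - 1 : ℕ) : ℝ) ≤ (Bv j : ℝ) * x.natAbs + F.N := by
      have : Bv j * x.natAbs + F.N - 1 ≤ Bv j * x.natAbs + F.N := Nat.sub_le _ _
      exact_mod_cast this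
    push_cast at h1'
    linarith
  rw [Nat.cast_natAbs, Int.cast_abs] at h2
  rw [div_add_one hNr.ne', le_div_iff₀ hNr]
  linarith

/-- The clearing denominator of the virtual box at the point `x`: `Dm = monDen αo (E x)`.
[cite: Nesterenko2003, Lemma 3.11; shape only] -/
def Dm (Bv : Fin (S.d + 1) → ℕ) (x : ℤ) : ℕ := MonomialDen.monDen F.αo (F.E Bv x)

/-- `1 ≤ Dm`. [folklore] -/
theorem one_le_Dm (Bv : Fin (S.d + 1) → ℕ) (x : ℤ) : 1 ≤ F.Dm Bv x := MonomialDen.one_le_monDen _ F.αo_ne _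

/-- `log Dm ≤ 2·Σⱼ Eⱼ(x)·h(αoⱼ)`. [cite: Nesterenko2003, §3.2; shape only] -/
theorem log_Dm_le (Bv : Fin (S.d + 1) → ℕ) (x : ℤ) :
    Real.log (F.Dm Bv x : ℝ) ≤ 2 * ∑ j, (F.E Bv x j : ℝ) * Height.logHeight₁ (F.αo j) :=
  MonomialDen.log_monDen_le _ F.αo_ne _

/-- `log Dm ≤ 2·|x|·Σⱼ (Bvⱼ/N)·Vⱼ + 2·Σⱼ Vⱼ` for weights `h(αoⱼ) ≤ Vⱼ` (the box-height ceiling with the rounding slop).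
[cite: Nesterenko2003, Lemma 3.11; shape only] -/
theorem log_Dm_le_of_weights (Bv : Fin (S.d + 1) → ℕ) (x : ℤ) (V : Fin (S.d + 1) → ℝ)
    (hV : ∀ j, Height.logHeight₁ (F.αo j) ≤ V j) :
    Real.log (F.Dm Bv x : ℝ) ≤ 2 * |(x : ℝ)| * ∑ j, ((Bv j : ℝ) / F.N) * V j + 2 * ∑ j, V j := by
  have h := F.log_Dm_le Bv x
  have h2 : ∑ j, (F.E Bv x j : ℝ) * Height.logHeight₁ (F.αo j) ≤ ∑ j, ((Bv j : ℝ) * |(x : ℝ)| / F.N + 1) * V j := by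
    refine Finset.sum_le_sum fun j _ => ?_
    exact mul_le_mul (F.E_le Bv x j) (hV j) (Height.zero_le_logHeight₁ _) (by have := F.E_le Bv x j; positivity)
  have h3 : ∑ j, ((Bv j : ℝ) * |(x : ℝ)| / F.N + 1) * V j = |(x : ℝ)| * ∑ j, ((Bv j : ℝ) / F.N) * V j + ∑ j, V j := by
    rw [Finset.mul_sum, ← Finset.sum_add_distrib]
    refine Finset.sum_congr rfl fun j _ => ?_
    ring
  linarith

/-! ### The monomials of the virtual box cleared -/

variable {ι : Type*} (R : ι → ℚ[X]) (u : ι → Fin S.d → ℤ) (uθ : ι → ℤ)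

/-- **The monomial of an unknown in the virtual box cleared**: for `|(κᵢ ᵥ* U)ⱼ| ≤ Bvⱼ` (`κᵢ = (uᵢ, u_θᵢ)`),
`Dm·zmon(uᵢ, u_θᵢ, x) ∈ ℤ` with `|·| ≤ Dm²`. [cite: Nesterenko2003, Lemma 3.11; shape only] -/
theorem exists_int_Dm_mul_zmon {Bv : Fin (S.d + 1) → ℕ} (i : ι)
    (hκ : ∀ j, |(S.allκ u uθ i ᵥ* F.U) j| ≤ (Bv j : ℤ)) (x : ℤ) :
    ∃ z : ℤ, ((F.Dm Bv x : ℕ) : ℚ) * S.zmon (u i) (uθ i) x = z ∧ |z| ≤ ((F.Dm Bv x : ℤ)) ^ 2 := by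
  have hμ : (fun j => x * S.allκ u uθ i j) = x • S.allκ u uθ i := by
    funext j; simp
  have hbox : ∀ j, |((fun j => x * S.allκ u uθ i j) ᵥ* F.U) j| ≤ (F.N : ℤ) * (F.E Bv x j : ℕ) := by
    intro j
    rw [hμ, Matrix.smul_vecMul, Pi.smul_apply, smul_eq_mul, abs_mul, mul_comm]
    have h1 : |(S.allκ u uθ i ᵥ* F.U) j| * |x| ≤ (Bv j : ℤ) * |x| := mul_le_mul_of_nonneg_right (hκ j) (abs_nonneg _)
    have h2 : (Bv j : ℤ) * |x| ≤ (F.N : ℤ) * (F.E Bv x j : ℕ) := by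
      have := F.le_N_mul_E Bv x j
      rw [Int.abs_eq_natAbs]
      exact_mod_cast this
    exact h1.trans h2
  rw [← S.prod_all_zpow_eq_zmon u uθ i x]
  exact SatCoords.exists_int_monDen_mul_prod_zpow_sat F.αo S.toQ.all F.U F.N F.hαo F.hall F.hN F.hU (F.E Bv x) _ hbox

/-- **The monomial datum of the k-step from the virtual box** (the hypothesis `hm` of
`PadicG3TwoValuesGen.g3_slab_kstep_*_gen`, with `Mm = Dm²`). [cite: Nesterenko2003, Lemma 3.11; shape only] -/
theorem monomialDatum_of_vbox {B : Finset ι} {Bv : Fin (S.d + 1) → ℕ}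
    (hκ : ∀ i ∈ B, ∀ j, |(S.allκ u uθ i ᵥ* F.U) j| ≤ (Bv j : ℤ)) :
    ∀ x : ℤ, ∀ i ∈ B, ∃ z₂ : ℤ, ((F.Dm Bv x : ℕ) : ℚ) * S.zmon (u i) (uθ i) x = z₂ ∧
      |z₂| ≤ ((F.Dm Bv x : ℤ)) ^ 2 :=
  fun x i hi => F.exists_int_Dm_mul_zmon u uθ i (hκ i hi) x

/-- **The box-height ceiling of the virtual box**: for `|(κᵢ ᵥ* U)ⱼ| ≤ Bvⱼ` and `h(αoⱼ) ≤ Vⱼ`,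
`h(zmon(uᵢ, u_θᵢ, x)) ≤ |x|·Σⱼ (Bvⱼ/N)·Vⱼ`. [cite: Nesterenko2003, Lemma 3.11; shape only] -/
theorem logHeight₁_zmon_le_of_vbox {Bv : Fin (S.d + 1) → ℕ} (i : ι)
    (hκ : ∀ j, |(S.allκ u uθ i ᵥ* F.U) j| ≤ (Bv j : ℤ)) (x : ℤ)
    (V : Fin (S.d + 1) → ℝ) (hV : ∀ j, Height.logHeight₁ (F.αo j) ≤ V j) :
    Height.logHeight₁ (S.zmon (u i) (uθ i) x) ≤ |(x : ℝ)| * ∑ j, ((Bv j : ℝ) / F.N) * V j := by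
  have hN' : (0 : ℝ) < F.N := by exact_mod_cast F.hN
  rw [← S.prod_all_zpow_eq_zmon u uθ i x]
  have h := SatCoords.natCast_mul_logHeight₁_prod_zpow_le F.αo S.toQ.all F.U F.N F.αo_ne F.hU
    (fun j => x * S.allκ u uθ i j)
  have hμ : (fun j => x * S.allκ u uθ i j) = x • S.allκ u uθ i := by
    funext j; simp
  have h2 : ∑ j, (|((fun j => x * S.allκ u uθ i j) ᵥ* F.U) j| : ℝ) * Height.logHeight₁ (F.αo j) ≤
      ∑ j, (F.N : ℝ) * (|(x : ℝ)| * (((Bv j : ℝ) / F.N) * V j)) := by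
    refine Finset.sum_le_sum fun j _ => ?_
    have h0 : 0 ≤ Height.logHeight₁ (F.αo j) := Height.zero_le_logHeight₁ _
    have h1 : (|((fun j => x * S.allκ u uθ i j) ᵥ* F.U) j| : ℝ) ≤ |(x : ℝ)| * (Bv j : ℝ) := by
      rw [hμ, Matrix.smul_vecMul, Pi.smul_apply, smul_eq_mul]
      push_cast
      rw [abs_mul]
      exact mul_le_mul_of_nonneg_left (by exact_mod_cast hκ j) (abs_nonneg _)
    have hB0 : (0 : ℝ) ≤ |(x : ℝ)| * Bv j := by positivity
    calc (|((fun j => x * S.allκ u uθ i j) ᵥ* F.U) j| : ℝ) * Height.logHeight₁ (F.αo j)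
        ≤ (|(x : ℝ)| * Bv j) * Height.logHeight₁ (F.αo j) := mul_le_mul_of_nonneg_right h1 h0
      _ ≤ (|(x : ℝ)| * Bv j) * V j := mul_le_mul_of_nonneg_left (hV j) hB0
      _ = (F.N : ℝ) * (|(x : ℝ)| * (((Bv j : ℝ) / F.N) * V j)) := by field_simp
  rw [← Finset.mul_sum, ← Finset.mul_sum] at h2
  exact le_of_mul_le_mul_left (h.trans h2) hN'

/-! ### The slab k-steps of the level chain with the datum supplied -/

/-- **The slab k-step from ALL the nodes** on the 𝔑-threaded family: `PadicG3TwoValuesGen.g3_slab_kstep_Icc_gen` at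
`Dm = monDen αo (E x)`, `Mm = Dm²`, the family in the virtual box `Bv`. [cite: Yu2013, Lemma 5.2]
[cite: Nesterenko2003, §4.2–4.3] -/
theorem kstep_Icc_sat (B : Finset ι) (p : ι → ℤ) (i₀ : ι) {m : ℕ}
    (hslab : ∀ i ∈ B, ‖S.δexpo u uθ i₀ i‖ ≤ ((2 : ℝ) ^ (m + 3))⁻¹) {N N' Tlo t : ℕ} (ht : 1 ≤ t)
    {Bw : ℝ} (hBw0 : 0 ≤ Bw) (hBw : ∀ i ∈ B, ∀ t₀ k, ‖(hw R i t₀).coeff k‖ * (4 * (2 : ℝ) ^ m) ^ k ≤ Bw)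
    (hzero : ∀ x : ℤ, |x| ≤ (N : ℤ) → ∀ τ'' : Tau S.d, tauNorm τ'' < Tlo → S.g3φ R u uθ B p τ'' x = 0)
    {Bv : Fin (S.d + 1) → ℕ} (hκ : ∀ i ∈ B, ∀ j, |(S.allκ u uθ i ᵥ* F.U) j| ≤ (Bv j : ℤ))
    (den₀ : ℤ → Tau S.d → ℕ) (hden₀ : ∀ x τ, 1 ≤ den₀ x τ) (M₀ : ℤ → Tau S.d → ℤ)
    (hR : ∀ (x : ℤ) (τ : Tau S.d), ∀ i ∈ B,
      ∃ z₀ : ℤ, (den₀ x τ : ℚ) * (hasseDeriv τ.1 (R i)).eval (x : ℚ) = z₀ ∧ |z₀| ≤ M₀ x τ)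
    {Xb : ℤ} (hX : ∀ i ∈ B, ∀ j, |S.dirScalar (u i) (uθ i) j| ≤ Xb) {P : ℤ} (hP : ∀ i ∈ B, |p i| ≤ P)
    (K : ℤ → Tau S.d → ℝ) (hK0 : ∀ x τ, 0 < K x τ)
    (hK : ∀ (x : ℤ) (τ : Tau S.d), (B.card : ℝ) * P * (M₀ x τ * (Xb : ℝ) ^ (∑ j, τ.2 j) *
      ((F.Dm Bv x : ℝ)) ^ 2) ≤ K x τ)
    (hfinal : ∀ x₁ : ℤ, |x₁| ≤ (N' : ℤ) → ∀ τ : Tau S.d, tauNorm τ + t ≤ Tlo →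
      max (Bw * ‖S.Λ₀‖ * (2 : ℝ) ^ t * (2 : ℝ) ^ condExp 2 (2 * N + 1) t)
        (Bw / (4 * (2 : ℝ) ^ m) ^ ((2 * N + 1) * t)) < 1 / K x₁ τ) :
    ∀ x₁ : ℤ, |x₁| ≤ (N' : ℤ) → ∀ τ : Tau S.d, tauNorm τ + t ≤ Tlo → S.g3φ R u uθ B p τ x₁ = 0 := by
  refine S.g3_slab_kstep_Icc_gen R u uθ B p i₀ hslab ht hBw0 hBw hzero den₀ hden₀ M₀ hR hX hP (F.Dm Bv)
    (F.one_le_Dm Bv) (fun x => ((F.Dm Bv x : ℤ)) ^ 2) (F.monomialDatum_of_vbox u uθ hκ) K hK0 (fun x τ => ?_) hfinal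
  have := hK x τ
  push_cast at this ⊢
  exact this

/-- **The slab k-step from the nodes COPRIME TO `3`** on the 𝔑-threaded family (the first sub-step after a third-step
descent). [cite: Yu2013, proof of Lemma 5.4] [cite: Nesterenko2003, §4.3] -/
theorem kstep_cop_sat (B : Finset ι) (p : ι → ℤ) (i₀ : ι) {m : ℕ}
    (hslab : ∀ i ∈ B, ‖S.δexpo u uθ i₀ i‖ ≤ ((2 : ℝ) ^ (m + 3))⁻¹) {N N' Tlo t : ℕ} (ht : 1 ≤ t)
    {Bw : ℝ} (hBw0 : 0 ≤ Bw) (hBw : ∀ i ∈ B, ∀ t₀ k, ‖(hw R i t₀).coeff k‖ * (4 * (2 : ℝ) ^ m) ^ k ≤ Bw)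
    (hzero : ∀ x : ℤ, |x| ≤ (N : ℤ) → ¬ (3 : ℤ) ∣ x → ∀ τ'' : Tau S.d, tauNorm τ'' < Tlo →
      S.g3φ R u uθ B p τ'' x = 0)
    {Bv : Fin (S.d + 1) → ℕ} (hκ : ∀ i ∈ B, ∀ j, |(S.allκ u uθ i ᵥ* F.U) j| ≤ (Bv j : ℤ))
    (den₀ : ℤ → Tau S.d → ℕ) (hden₀ : ∀ x τ, 1 ≤ den₀ x τ) (M₀ : ℤ → Tau S.d → ℤ)
    (hR : ∀ (x : ℤ) (τ : Tau S.d), ∀ i ∈ B,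
      ∃ z₀ : ℤ, (den₀ x τ : ℚ) * (hasseDeriv τ.1 (R i)).eval (x : ℚ) = z₀ ∧ |z₀| ≤ M₀ x τ)
    {Xb : ℤ} (hX : ∀ i ∈ B, ∀ j, |S.dirScalar (u i) (uθ i) j| ≤ Xb) {P : ℤ} (hP : ∀ i ∈ B, |p i| ≤ P)
    (K : ℤ → Tau S.d → ℝ) (hK0 : ∀ x τ, 0 < K x τ)
    (hK : ∀ (x : ℤ) (τ : Tau S.d), (B.card : ℝ) * P * (M₀ x τ * (Xb : ℝ) ^ (∑ j, τ.2 j) *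
      ((F.Dm Bv x : ℝ)) ^ 2) ≤ K x τ)
    (hfinal : ∀ x₁ : ℤ, |x₁| ≤ (N' : ℤ) → ∀ τ : Tau S.d, tauNorm τ + t ≤ Tlo →
      max (Bw * ‖S.Λ₀‖ * (2 : ℝ) ^ t * (2 : ℝ) ^ condExp 2 (2 * N + 1) t)
        (Bw / (4 * (2 : ℝ) ^ m) ^ (2 * (N - N / 3) * t)) < 1 / K x₁ τ) :
    ∀ x₁ : ℤ, |x₁| ≤ (N' : ℤ) → ∀ τ : Tau S.d, tauNorm τ + t ≤ Tlo → S.g3φ R u uθ B p τ x₁ = 0 := by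
  refine S.g3_slab_kstep_cop_gen R u uθ B p i₀ hslab ht hBw0 hBw hzero den₀ hden₀ M₀ hR hX hP (F.Dm Bv)
    (F.one_le_Dm Bv) (fun x => ((F.Dm Bv x : ℤ)) ^ 2) (F.monomialDatum_of_vbox u uθ hκ) K hK0 (fun x τ => ?_) hfinal
  have := hK x τ
  push_cast at this ⊢
  exact this

end SatData

end TwoSetup

end Summit.ABC.StewartYu

end
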